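import Literature.Analysis.FluidPDE.NSBoundedMildOseen
import Literature.Analysis.FluidPDE.SelfSimilar
import Literature.Analysis.FluidPDE.SuitableWeak
import Literature.Analysis.FunctionSpaces.WeakLp
import HarnessLib

/-!
# Barker–Prange 2021, §1: quantitative blow-up rates — the logarithmic local `L³` rate under a
# Type-I bound, its optimality for backward DSS solutions, and the quantified Seregin criterion

Topic `Analysis/FluidPDE`. Source: T. Barker, C. Prange, *Quantitative regularity for the
Navier–Stokes equations via spatial concentration*, Comm. Math. Phys. 385 (2021) 717–792,
doi:10.1007/s00220-021-04122-x = arXiv:2003.06717 [`BarkerPrange2021`]; read in the arXiv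
version (held text `paper:arxiv-2003.06717`): §1 (pp. 3–4: the Type I bound, **Theorem 1**,
**Corollary 1**, **Theorem 2**), §1.4 (notation: mild / suitable / finite-energy solutions, the
Lorentz quasi-norm), §2.2 (proofs of the main results). Numbering is that of the arXiv version.
This file is one of two for this source (D-0064: one file per section); the effective regularity
criteria and the bound on the number of Type-I singular points of §4 are typed separately.

## The printed statements (unit viscosity, no force)

* (p. 3) "if `u` is a finite-energy solution that first blows-up at `T* > 0` we say that `T*` is a
  Type I blow-up if `‖u‖_{L^∞(0,T*; L^{3,∞}(ℝ³))} ≤ M`."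
* **Theorem 1** (rate of blow-up, Type I). "There exists a universal constant `M₀ ∈ [1,∞)` such
  that for all `M ≥ M₀` and `δ ∈ (0,1)` the following holds true. Assume that `u` is a mild
  solution to the Navier–Stokes equations on `ℝ³ × [0,T*)` with `u ∈ L^∞_loc([0,T*); L^∞(ℝ³))`.
  Assume that `‖u‖_{L^∞_t L^{3,∞}_x(ℝ³ × (0,T*))} ≤ M` and `u` has a singular point at
  `(x,t) = (0,T*)`. In particular `u ∉ L^∞_{x,t}(Q_{(0,T*)}(r))` for all sufficiently small `r > 0`.
  Then … there exists `c(δ,M,T*) ∈ (0,∞)` … such that for any `t ∈ (max(T*/2, T* − c), T*)` we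
  have `∫_{B_0((T*)^{1/2}(T* − t)^{(1−δ)/2})} |u(x,t)|³ dx ≥ log(1/(T* − t)^{δ/2}) / exp(exp(M^{1025}))`."
* **Corollary 1.** "Suppose `u : ℝ³ × (−∞,0) → ℝ³` is a non-zero `λ`-DSS to the Navier–Stokes
  equations such that `u ∈ C^∞(ℝ³ × (−∞,0)) ∩ C((−∞,0); L^p(ℝ³))` for some `p ∈ [3,∞)`. There
  exists `M > 1` such that for every `δ ∈ (0,1)` there is a `C(δ,M) ∈ (0,∞)` with … for all
  `t ∈ [max(−½, −C(δ,M)), 0)` we have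
  `log(1/(−t)^{δ/2}) / exp(exp(M^{1025})) ≤ ∫_{B_0(1)} |u(x,t)|³ ≤ M³ log(2/√(−t))`."
  (`λ`-DSS, p. 3: "there exists `λ ∈ (1,∞)` such that `u(x,t) = λu(λx, λ²t)`".)
* **Theorem 2** (main quantitative estimate, time slices; quantification of Seregin's result).
  "There exists a universal constant `M₁ ∈ [1,∞)`. Let `M ∈ [M₁,∞)`. We define `M♭` by
  `M♭ := exp(L_* M⁵/2)`, for an appropriate constant `L_* ∈ (0,∞)`. Let `(u,p)` be a finite-energy
  `C^∞(ℝ³ × (−1,0))` solution to the Navier–Stokes equations on `ℝ³ × [−1,0]`. Assume that there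
  exists `t_(k) ∈ [−1,0)` such that `t_(k) ↑ 0` with `sup_k ‖u(·,t_(k))‖_{L³(ℝ³)} ≤ M`. Select any
  “well-separated” subsequence (still denoted `t_(k)`) such that
  `sup_k (−t_(k+1))/(−t_(k)) < exp(−2(M♭)^{1223})`. Then for `j := ⌈exp(exp((M♭)^{1224}))⌉ + 1`,
  we have the bound `‖u‖_{L^∞(ℝ³ × (t_(j+1)/4, 0))} ≤ C₁ M^{−23} / (−t_(j+1))^{1/2}`, for a universal
  constant `C₁ ∈ (0,∞)`." (Abstract: this quantifies Seregin 2012 — the tree's proved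
  `seregin_L3_blowup` / `seregin_regular_of_liminf_L3` — "which says that if `u` is a smooth
  finite-energy solution … with `sup_n ‖u(·,t_(n))‖_{L³} < ∞` and `t_(n) ↑ 1`, then `u` does not
  blow-up at `t = 1`", and "generalizes Theorem 1.2 in [Tao19]" = the tree's fact
  `tao_quantitative_ess`.)

## Contents

* `barkerPrange2021_typeI_log_rate` — Theorem 1 (named fact, D-0014).
* `barkerPrange2021_dss_log_rate` — Corollary 1 (named fact).
* `barkerPrange2021_quantitative_seregin` — Theorem 2 (named fact; the "`QuantitativeSereginLim`"
  of the N0 routes, which had no tree counterpart).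

## Transcription notes (never stronger than print)

* *Classes (§1.4.3, p. 9).* "Mild solution on `[0,T]`" = the Duhamel formula
  `u(x,t) = e^{tΔ}u(·,0) + ∫₀ᵗ ℙ∂ᵢ e^{(t−s)Δ} uᵢuⱼ ds` for all `t ∈ [0,T]`, rendered pointwise with
  the tree's caloric extension and Oseen bilinear term, `u t x = e^{νtΔ}(u 0)(x) − B^ν_0(u,u)(t)(x)`
  (`UnboundedOperators.heatExtension`, `oseenDuhamel`, sign convention of `NSBoundedMildOseen`:
  `u = e^{νtΔ}u₀ − B^ν_0(u,u)`), for `0 < t < T*` (at `t = 0` the printed identity is a tautology,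
  and the tree's `heatExtension · 0` is junk); "`u ∈ L^∞_loc([0,T*); L^∞)`" = `IsBoundedOn (Icc 0 T') u`
  for every `T' < T*` (an everywhere bound on an honest function) plus joint measurability on
  `[0,T*) × ℝ³`. "Finite-energy solution on `ℝ³ × (T₁,T)`" (distributional solution,
  `u ∈ C_w([T₁,T]; L²_σ) ∩ L²_t Ḣ¹`, global energy inequality from `T₁`) is implied by the tree's
  Leray–Hopf class `IsLerayHopfOn` (weak solution, `L^∞_t L²` with every slice in `L²`, weak
  gradient in `L²_{t,x}`, energy inequality from the initial time for every `t` and from a.e. time,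
  weak `L²` continuity, strong attainment of the datum); "`C^∞(ℝ³ × (−1,0))` solution `(u,p)`" =
  `IsClassicalNSSolutionOn (Ioo · ·) ν 0 u p` on the open slab.
* *Type I bound.* `‖g‖_{L^{3,∞}} = sup_{α>0} α d_g(α)^{1/3}` (§1.4.4), so `‖u(·,t)‖_{L^{3,∞}} ≤ M` is
  `eWeakLpPow (u t) 3 volume ≤ (ofReal M)³` (`FunctionSpaces.eWeakLpPow = sup_t t^p μ{t < ‖f‖}`);
  the `L^∞_t` (ess-sup) bound is imposed at every `t` of the open interval (stronger hypothesis).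
* *Singular point at `(0,T*)`* (§1.4.2: `Q_{(x,t)}(r) = B_r(x) × (t − r², t)`; Thm 1: "`u ∉ L^∞(Q_{(0,T*)}(r))`
  for all sufficiently small `r`") = essential unboundedness of `uncurry u` on the tree's backward
  `parabolicCylinder r (T*, 0) = (T* − r², T*) × B_r(0)` for every `0 < r`, `r² < T*` ("all small `r`"
  and "all admissible `r`" agree by monotonicity of the cylinders) — the convention of
  `BarkerPrange2020_thm2` and `albritton_singular_point_of_blowup`.
* *Constants and quantifier order.* `M₀, M₁, L_*, C₁` universal: outermost existentials. In Thm 1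
  the printed `c(δ,M,T*)` is recorded AFTER the solution (`∃ c > 0` possibly depending on `u` — a
  weaker statement than the printed uniform one, sufficient for every rate application). In Cor 1,
  `M > 1` depends on `u`, `C(δ,M)` on `δ` (after `M`, `u` are fixed), as printed. In Thm 2 the
  sequence is indexed by `ℕ` from `0`; the printed hypotheses on `(t_(k))_{k ≥ 1}` follow from ours on
  all `k ≥ 0` by forgetting `t 0`, so the printed conclusion at the printed index `j + 1` is our
  `t (j + 1)`; "`t_(k) ↑ 0`" is recorded as `StrictMono t ∧ Tendsto t atTop (𝓝 T)` (both already
  forced by the separation condition, kept for legibility); `‖u‖_{L^∞(ℝ³ × (a,0))}` of the smooth `u`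
  on the open slab is the everywhere bound `∀ s ∈ Ioo a T, ∀ x, ‖u s x‖ ≤ …`.
* *Viscosity, time origin, scaling.* Printed for `ν = 1`, on `[0,T*)` (Thm 1), `(−∞,0)` (Cor 1),
  `[−1,0]` (Thm 2). Recorded for every `ν > 0` through `w(y,s) = ν⁻¹u(y,s/ν)` (a unit-viscosity
  solution; `B^ν_0`/`e^{νtΔ}` become `B^1_0`/`e^{sΔ}`, `‖w(s)‖_{L³} = ν⁻¹‖u(s/ν)‖_{L³}`,
  `eWeakLpPow (w s) 3 = ν⁻³ eWeakLpPow (u (s/ν)) 3`, `∫_B |w(s)|³ = ν⁻³ ∫_B |u(s/ν)|³`, DSS and all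
  solution classes are preserved) — exactly as `BarkerPrange2020_thm2` is recorded — and, for
  Thm 2, additionally through the Navier–Stokes scaling `λu(λx, T + λ²t)`, `λ² = νT… ` (precisely:
  `w(y,s) = (λ/ν) u(λy, T + λ²s/ν)`, `λ = √(νT)`, maps a viscosity-`ν` solution on `[0,T]` to a
  unit-viscosity solution on `[−1,0]`; `‖w(s_k)‖₃ = ν⁻¹‖u(t_k)‖₃`, the separation ratios
  `(−s_(k+1))/(−s_(k)) = (T − t_(k+1))/(T − t_(k))` are unchanged, and the conclusion
  `|w| ≤ C₁M^{−23}(−s_(j+1))^{−1/2}` on `(s_(j+1)/4, 0)` reads `|u(x,t)| ≤ C₁M^{−23}√ν (T − t_(j+1))^{−1/2}`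
  for `t ∈ (T − (T − t_(j+1))/4, T)`), so that Thm 2 is stated on the tree's Leray–Hopf frame
  `[0,T]`, `T > 0`, with the sequence `t_(k) ↑ T`. For Thm 1 with viscosity `ν` the substitution
  `s = νt` turns the printed ball radius `(νT)^{1/2}(ν(T−t))^{(1−δ)/2}` into
  `ν^{1−δ/2} T^{1/2} (T−t)^{(1−δ)/2}`, the threshold into `log(1/(ν(T−t))^{δ/2})`, the Type I bound
  into `‖u(t)‖_{L^{3,∞}} ≤ νM`, and the lower bound acquires the factor `ν³`; the time window
  `(max(νT/2, νT − c), νT)` becomes `(max(T/2, T − c/ν), T)`, absorbed in `∃ c`.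
* Not here: Propositions 2–3 (the main quantitative estimates), §§3–6, Props 7, 8, 10 and Cor 9
  (§4, the companion file), the journal's possibly different theorem labels.

## Mathlib / tree search

`lean search 'BarkerPrange2021|2003.06717|quantitative_seregin|log_rate'`: the key
`BarkerPrange2021` was cited only in prose (barrier `CriticalNormBlowupNecessity`, N0 theses); no
transcription of Thms 1–2 / Cor 1 (2026-08-26; the cell restatement `QuantitativeSereginLim` named
in the typer's SOURCE-DECL-MAP §4 is not a tree declaration). Reused tree vocabulary:
`oseenDuhamel` (`NSBoundedMildOseen.lean`), `UnboundedOperators.heatExtension`, `IsBoundedOn`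
(`MildSolution.lean`), `FunctionSpaces.eWeakLpPow` (`WeakLp.lean`), `parabolicCylinder`
(`SuitableWeak.lean`), `IsLerayHopfOn`, `ContinuousInLpOn` (`LerayHopf.lean`),
`IsClassicalNSSolutionOn` (`ClassicalSolution.lean`), `IsDiscretelySelfSimilar` (`SelfSimilar.lean`).
Mathlib has no Navier–Stokes or Lorentz-space notions.

## References

* T. Barker, C. Prange, Comm. Math. Phys. 385 (2021) 717–792 = arXiv:2003.06717: §1 pp. 3–4
  (Type I bound, Thm. 1, Cor. 1, Thm. 2), §1.4 pp. 8–9, §2.2 pp. 10–11. [`BarkerPrange2021`]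
* G. Seregin, Comm. Math. Phys. 312 (2012) 833–845, Thm. 1.1 (the tree's `seregin_L3_blowup`,
  proved). [`Seregin2012`]
* T. Tao, in *Nine mathematical challenges*, PSPM 104 (2021), Thm. 1.2 (the tree's
  `tao_quantitative_ess`). [`Tao2021`]
* T. Barker, C. Prange, ARMA 236 (2020), Thm. 2 (the tree's `BarkerPrange2020_thm2`, used in the
  proof of Thm. 1). [`BarkerPrange2020`]
-/

noncomputable section

open MeasureTheory Set Function Metric Filter
open _root_.Topology
open scoped ENNReal

namespace Literature.Analysis.FluidPDE

/-- **Barker–Prange 2021, Theorem 1 (logarithmic local `L³` blow-up rate at a Type-I singular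
point).** There is a universal `M₀ ≥ 1` such that for all `M ≥ M₀`, `δ ∈ (0,1)`, every viscosity
`ν > 0` and every `T = T* > 0` the following holds. Let `u : [0,T) × ℝ³ → ℝ³` be a mild solution
of the unforced Navier–Stokes equations with viscosity `ν` — jointly measurable, with
`u(t) = e^{νtΔ}u(0) − B^ν_0(u,u)(t)` pointwise for `0 < t < T` — which is bounded on every
`[0,T'] × ℝ³`, `T' < T` (`u ∈ L^∞_loc([0,T*); L^∞)`), satisfies the **Type I bound**
`‖u(t)‖_{L^{3,∞}} ≤ νM` for `0 < t < T` (`sup_{α>0} α³ |{α < |u(t)|}| ≤ (νM)³`), and has a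
**singular point at `(T, 0)`** (`u` is essentially unbounded on every backward cylinder
`(T − r², T) × B_r(0)`, `0 < r`, `r² < T`). Then there is `c > 0` such that for every
`t ∈ (max(T/2, T − c), T)`,
`∫_{B_0(ν^{1−δ/2} T^{1/2} (T − t)^{(1−δ)/2})} |u(x,t)|³ dx ≥ ν³ log(1/(ν(T − t))^{δ/2}) / exp(exp(M^{1025}))`
(in `ℝ≥0∞`; printed for `ν = 1`, where it reads
`∫_{B_0(T^{1/2}(T−t)^{(1−δ)/2})} |u|³ ≥ log(1/(T−t)^{δ/2})/exp(exp(M^{1025}))`; general `ν` by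
`w(y,s) = ν⁻¹u(y,s/ν)`, module docstring). In particular the local `L³` norm on a ball of radius
`O((T−t)^{1/2−})` blows up at least like `C(M) log(1/(T−t))`. [cite: BarkerPrange2021, Thm. 1 (arXiv:2003.06717 §1 p. 3; proof §2.2 pp. 10–11)] -/
def barkerPrange2021_typeI_log_rate : Prop :=
  ∃ M₀ : ℝ, 1 ≤ M₀ ∧ ∀ M : ℝ, M₀ ≤ M → ∀ δ : ℝ, 0 < δ → δ < 1 →
    ∀ (ν T : ℝ), 0 < ν → 0 < T →
    ∀ u : ℝ → EuclideanSpace ℝ (Fin 3) → EuclideanSpace ℝ (Fin 3),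
      AEStronglyMeasurable (uncurry u) (volume.restrict (Ico 0 T ×ˢ univ)) →
      (∀ t ∈ Ioo 0 T, ∀ x,
        u t x = UnboundedOperators.heatExtension (u 0) (ν * t) x - oseenDuhamel ν 0 u u t x) →
      (∀ T' ∈ Ioo 0 T, IsBoundedOn (Icc 0 T') u) →
      (∀ t ∈ Ioo 0 T, FunctionSpaces.eWeakLpPow (u t) 3 volume ≤ ENNReal.ofReal (ν * M) ^ (3 : ℕ)) →
      (∀ r : ℝ, 0 < r → r ^ 2 < T →
        eLpNorm (uncurry u) ∞
          (volume.restrict (parabolicCylinder r (T, (0 : EuclideanSpace ℝ (Fin 3))))) = ∞) →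
      ∃ c : ℝ, 0 < c ∧ ∀ t ∈ Ioo (max (T / 2) (T - c)) T,
        ENNReal.ofReal (ν ^ 3 * Real.log (1 / (ν * (T - t)) ^ (δ / 2)) /
            Real.exp (Real.exp (M ^ (1025 : ℕ)))) ≤
          ∫⁻ x in ball (0 : EuclideanSpace ℝ (Fin 3))
              (ν ^ (1 - δ / 2) * T ^ (1 / 2 : ℝ) * (T - t) ^ ((1 - δ) / 2)), ‖u t x‖ₑ ^ (3 : ℕ)

/-- **Barker–Prange 2021, Corollary 1 (optimality of the logarithmic rate for backward discretely
self-similar solutions).** Let `ν > 0` and let `u : (−∞,0) × ℝ³ → ℝ³` be a non-zero backward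
`λ`-DSS solution of the unforced Navier–Stokes equations with viscosity `ν` for some `λ > 1`
(`λu(λ²t, λx) = u(t,x)`, the tree's `IsDiscretelySelfSimilar`), smooth on the open past
(`IsClassicalNSSolutionOn (Iio 0) ν 0 u p` for some pressure `p`) and in `C((−∞,0); L^q(ℝ³))` for
some `q ∈ [3,∞)`. Then there is `M > 1` such that for every `δ ∈ (0,1)` there is `C > 0` with
`ν³ log(1/(−νt)^{δ/2}) / exp(exp(M^{1025})) ≤ ∫_{B_0(1)} |u(x,t)|³ dx ≤ ν³ M³ log(2/√(−νt))` for all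
`t ∈ [max(−1/(2ν), −C), 0)` (in `ℝ≥0∞`; printed for `ν = 1`: window `[max(−½, −C(δ,M)), 0)`, bounds
`log(1/(−t)^{δ/2})/exp(exp(M^{1025})) ≤ ∫_{B_0(1)}|u|³ ≤ M³ log(2/√(−t))`; general `ν` by
`w(y,s) = ν⁻¹u(y,s/ν)`, module docstring). The spatial exponent is called `q` because `p` is the
pressure. [cite: BarkerPrange2021, Cor. 1 (arXiv:2003.06717 §1 pp. 3–4; proof §2.2 p. 11)] -/
def barkerPrange2021_dss_log_rate : Prop :=
  ∀ (ν : ℝ), 0 < ν → ∀ (u : ℝ → EuclideanSpace ℝ (Fin 3) → EuclideanSpace ℝ (Fin 3))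
    (p : ℝ → EuclideanSpace ℝ (Fin 3) → ℝ) (lam : ℝ), 1 < lam →
    IsDiscretelySelfSimilar lam u → IsClassicalNSSolutionOn (Iio 0) ν 0 u p →
    (∃ q : ℝ≥0∞, 3 ≤ q ∧ q < ∞ ∧ ContinuousInLpOn (Iio 0) q u) →
    (∃ t, t < 0 ∧ ∃ x, u t x ≠ 0) →
    ∃ M : ℝ, 1 < M ∧ ∀ δ : ℝ, 0 < δ → δ < 1 → ∃ C : ℝ, 0 < C ∧
      ∀ t ∈ Ico (max (-(1 / (2 * ν))) (-C)) 0,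
        ENNReal.ofReal (ν ^ 3 * Real.log (1 / (-(ν * t)) ^ (δ / 2)) /
            Real.exp (Real.exp (M ^ (1025 : ℕ)))) ≤
          ∫⁻ x in ball (0 : EuclideanSpace ℝ (Fin 3)) 1, ‖u t x‖ₑ ^ (3 : ℕ) ∧
        ∫⁻ x in ball (0 : EuclideanSpace ℝ (Fin 3)) 1, ‖u t x‖ₑ ^ (3 : ℕ) ≤
          ENNReal.ofReal (ν ^ 3 * M ^ 3 * Real.log (2 / Real.sqrt (-(ν * t))))

/-- The constant `M♭ = exp(L_* M⁵ / 2)` of Barker–Prange 2021, Theorem 2, as a function of the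
universal constant `L = L_*` and of `M`. [cite: BarkerPrange2021, Thm. 2 (arXiv:2003.06717 §1 p. 4)] -/
def barkerPrange2021Mflat (L M : ℝ) : ℝ :=
  Real.exp (L * M ^ 5 / 2)

/-- Unfolding `barkerPrange2021Mflat`. [cite: BarkerPrange2021, Thm. 2 (arXiv:2003.06717 §1 p. 4)] -/
theorem barkerPrange2021Mflat_def (L M : ℝ) :
    barkerPrange2021Mflat L M = Real.exp (L * M ^ 5 / 2) :=
  rfl

/-- `M♭ > 0`. [cite: BarkerPrange2021, Thm. 2 (arXiv:2003.06717 §1 p. 4)] -/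
theorem barkerPrange2021Mflat_pos (L M : ℝ) : 0 < barkerPrange2021Mflat L M :=
  Real.exp_pos _

/-- The index `j = ⌈exp(exp((M♭)^{1224}))⌉ + 1` of Barker–Prange 2021, Theorem 2. [cite: BarkerPrange2021, Thm. 2 (arXiv:2003.06717 §1 p. 4)] -/
def barkerPrange2021Index (L M : ℝ) : ℕ :=
  ⌈Real.exp (Real.exp (barkerPrange2021Mflat L M ^ (1224 : ℕ)))⌉₊ + 1

/-- Unfolding `barkerPrange2021Index`. [cite: BarkerPrange2021, Thm. 2 (arXiv:2003.06717 §1 p. 4)] -/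
theorem barkerPrange2021Index_def (L M : ℝ) :
    barkerPrange2021Index L M =
      ⌈Real.exp (Real.exp (barkerPrange2021Mflat L M ^ (1224 : ℕ)))⌉₊ + 1 :=
  rfl

/-- **Barker–Prange 2021, Theorem 2 (quantification of Seregin's `L³` criterion along time
slices).** There are universal constants `M₁ ≥ 1`, `L = L_* > 0` and `C₁ > 0` such that for every
`M ≥ M₁`, with `M♭ = exp(L M⁵/2)` and `j = ⌈exp(exp((M♭)^{1224}))⌉ + 1`, every viscosity `ν > 0` and
every `T > 0` the following holds. Let `(u,p)` be a smooth solution of the unforced Navier–Stokes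
equations with viscosity `ν` on the open slab `(0,T) × ℝ³` which is a finite-energy (Leray–Hopf)
solution on `[0,T]` from a datum `u₀`, and let `t : ℕ → ℝ` be times `0 ≤ t_k < T`, `t_k ↑ T`, with
`sup_k ‖u(t_k)‖_{L³} ≤ νM`, **well separated**: `(T − t_(k+1))/(T − t_k) < exp(−2(M♭)^{1223})` for
all `k`. Then `|u(x,s)| ≤ C₁ M^{−23} √ν / √(T − t_(j+1))` for all `x` and all
`s ∈ (T − (T − t_(j+1))/4, T)`; in particular `u` does not blow up at `T`. Printed for `ν = 1` on
`ℝ³ × [−1,0]` with `t_(k) ↑ 0`, `sup_k ‖u(·,t_(k))‖_{L³} ≤ M`,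
`sup_k (−t_(k+1))/(−t_(k)) < exp(−2(M♭)^{1223})` and the conclusion
`‖u‖_{L^∞(ℝ³ × (t_(j+1)/4, 0))} ≤ C₁M^{−23}(−t_(j+1))^{−1/2}`; the general frame by the
Navier–Stokes scaling and `w(y,s) = ν⁻¹u(y,s/ν)` (module docstring). This quantifies the tree's
proved `seregin_regular_of_liminf_L3` / `seregin_L3_blowup` (Seregin 2012) and generalizes the fact
`tao_quantitative_ess` (Tao 2021, Thm. 1.2). [cite: BarkerPrange2021, Thm. 2 (arXiv:2003.06717 §1 p. 4; proof §2.2 p. 11)] -/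
def barkerPrange2021_quantitative_seregin : Prop :=
  ∃ M₁ : ℝ, 1 ≤ M₁ ∧ ∃ L : ℝ, 0 < L ∧ ∃ C₁ : ℝ, 0 < C₁ ∧ ∀ M : ℝ, M₁ ≤ M →
    ∀ (ν T : ℝ), 0 < ν → 0 < T →
      ∀ (u₀ : EuclideanSpace ℝ (Fin 3) → EuclideanSpace ℝ (Fin 3))
        (u : ℝ → EuclideanSpace ℝ (Fin 3) → EuclideanSpace ℝ (Fin 3)) (p : ℝ → EuclideanSpace ℝ (Fin 3) → ℝ),
        IsClassicalNSSolutionOn (Ioo 0 T) ν 0 u p → IsLerayHopfOn T ν 0 u₀ u →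
        ∀ t : ℕ → ℝ, (∀ k, t k ∈ Ico 0 T) → StrictMono t → Tendsto t atTop (𝓝 T) →
          (∀ k, eLpNorm (u (t k)) 3 volume ≤ ENNReal.ofReal (ν * M)) →
          (∀ k, (T - t (k + 1)) / (T - t k) <
            Real.exp (-2 * barkerPrange2021Mflat L M ^ (1223 : ℕ))) →
          ∀ s ∈ Ioo (T - (T - t (barkerPrange2021Index L M + 1)) / 4) T,
          ∀ x : EuclideanSpace ℝ (Fin 3),
            ‖u s x‖ ≤ C₁ * M ^ (-(23 : ℤ)) * Real.sqrt ν /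
              Real.sqrt (T - t (barkerPrange2021Index L M + 1))

end Literature.Analysis.FluidPDE

end
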